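import Summits.BirchSwinnertonDyer.BirchSwinnertonDyer.Theorems.KatoDescentPotSupersingularMemberIndexOfValue
import HarnessLib

/-!
# The NON-DEGENERACY clauses `z_ne_zero` (`z_γ⁰ ≠ 0`, Thm. 12.5 (1)) and `lam_constantCoeff_ne_zero`
# (`λ(0) ≠ 0`, Lemma 13.10 (1) with `γ_*^+ ≠ 0`) of `Kato2004.MemberHull{,Zeta}Inputs` (item 19659 /
# wi-78945, crux M stmt-BirchSwinnertonDyer-19196 `ReducibleKatoMember`) follow from the HULL fields and the
# non-torsion of the bottom class `proj₀ 𝐲` — hence from the VALUE of the `ZetaBody` witness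

Cell `bsd-potss`, seat `bsd-potss-rkm` generation 10; ROUTE-FREE; `--supports stmt-BirchSwinnertonDyer-19196`.

Companion of `Theorems/KatoDescentPotSupersingularMemberIndexOfValue.lean` (this seat, p525403:
`not_isOfFinAddOrder_proj_zero_of_zetaBody` — `proj₀ 𝐲` is not torsion as soon as `κ′ ≠ 0`, `L(V,1) ≠ 0` for
the curve `V` of the newform, the (C5) guards hold and the four-cusp factor `R⁻(c,d,a,A;d′)` is non-zero)
and of `…MemberHullRankOne.lean` (`isTorsion_quotient` from the rank).  Here, on ANY hull
`j : 𝐇¹_Γ ↪ F` with finite cokernel and any factorisation `j 𝐲 = λ • z` in `F`: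
* §1 `exists_C_smul_mem_of_finite_quotient` — a finite quotient `F ⧸ N` of a `Λ`-module is killed
  elementwise by non-zero CONSTANTS: `∃ c ∈ ℤ_p ∖ 0, C(c)·f ∈ N` (pigeonhole on `c ↦ C(c)·f̄`).
* §2 `constantCoeff_ne_zero_of_hull_smul` — if `proj₀ 𝐲` is not torsion then `λ(0) ≠ 0`: otherwise
  `λ = X·μ`, some `C(c)·(μ·z) = j h` (§1), so `C(c)·𝐲 = X·h` by injectivity of `j` and
  `c · proj₀ 𝐲 = proj₀(X·h) = 0` (`IwasawaH1Data.proj_zero_smul`, `proj_zero_X_smul`), i.e. `proj₀ 𝐲` torsion;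
  `ne_zero_of_hull_smul` — `z ≠ 0` (else `j 𝐲 = 0`, `𝐲 = 0`); `ne_zero_of_not_isOfFinAddOrder_proj_zero` —
  `𝐲 ≠ 0`.
* §3 on the zeta package over a `ZetaBody` lift: **`MemberHullZetaInputs.lam_constantCoeff_ne_zero_of_value`**
  and **`MemberHullZetaInputs.z_ne_zero_of_value`** — the two clauses re-derived WITHOUT using them (nor
  `isTorsion_quotient`, `index_ne_zero`), from `j`, `j_injective`, `finite_coker`, `j_y` and the value.

CONSEQUENCE (planner / typer; nothing edited here): with p525403 and `…MemberHullRankOne`, a re-type of the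
held input that adds the elementary witness guard `Int.gcd (c*d) A = 1 ∧ ∃ d′, d·d′ ≡ 1 [ZMOD A] ∧
cuspFactor f true (fun _ ↦ 1) c d a A d′ ≠ 0` may DROP the four clauses `z_ne_zero`, `isTorsion_quotient`,
`lam_constantCoeff_ne_zero`, `index_ne_zero` of `MemberHullZetaInputs`.  HONEST FRAMING: nothing is booked;
the zeta fact stays a transcription of Kato Thm. 12.5 (3)/12.6/13.10 (1)/13.14/14.16 (2) + Wuthrich L.14 at
the member; BSD is not advanced.

References: K. Kato, Astérisque 295 (2004), Thm. 12.5 (1) (p. 221), Lemma 13.10 (1) (p. 230), 13.14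
(p. 234), Thm. 14.5 (2) (p. 236), §14.14 (14.14.1) (p. 243) [Kato2004Asterisque]; tree
`Kato2004/IwasawaH2DataOfInjectivityProofs` (`proj_zero_smul`), `Kato2004/IwasawaCohomologyLevelZero`
(`proj_zero_X_smul`), `Theorems/KatoDescentPotSupersingularIntegralH1RankZeroIndex` (`isOfFinAddOrder_of_smul_eq_zero`).
-/

set_option autoImplicit false
set_option linter.dupNamespace false

noncomputable section

open scoped NumberField TensorProduct
open Field IsDedekindDomain CongruenceSubgroup Function
open Literature.NumberTheory.GaloisRepresentations
open Literature.NumberTheory.EllipticCurves Literature.NumberTheory.EllipticCurves.ModularForms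
open Literature.NumberTheory.EllipticCurves.Kato2004
open Literature.NumberTheory.EllipticCurves.Kato2004.EulerSystemValues Rat.HeightOneSpectrum
open Literature.NumberTheory.EllipticCurves.IwasawaAlgebra

namespace Summit.BirchSwinnertonDyer.BirchSwinnertonDyer.Theorems.MemberHullNondegenerate

/-! ## §1 Finite quotients are killed by non-zero constants -/

section Algebra

variable (p : ℕ) [Fact p.Prime]

/-- In a `Λ`-module `F` with `F ⧸ N` finite, every `f ∈ F` has `C(c)·f ∈ N` for some non-zero constant
`c ∈ ℤ_p` (pigeonhole on `c ↦ C(c)·f mod N`). [folklore] -/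
theorem exists_C_smul_mem_of_finite_quotient {F : Type*} [AddCommGroup F] [Module (IwasawaAlgebra p) F]
    (N : Submodule (IwasawaAlgebra p) F) [Finite (F ⧸ N)] (f : F) :
    ∃ c : ℤ_[p], c ≠ 0 ∧ (PowerSeries.C c : IwasawaAlgebra p) • f ∈ N := by
  obtain ⟨c₁, c₂, hne, heq⟩ := Finite.exists_ne_map_eq_of_infinite
    (fun c : ℤ_[p] => (Submodule.Quotient.mk ((PowerSeries.C c : IwasawaAlgebra p) • f) : F ⧸ N))
  refine ⟨c₁ - c₂, sub_ne_zero.mpr hne, ?_⟩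
  have h := (Submodule.Quotient.eq N).mp heq
  rwa [← sub_smul, ← map_sub] at h

end Algebra

/-! ## §2 On a hull over the pin -/

section Pin

variable {W : WeierstrassCurve ℚ} [W.IsElliptic] {p : ℕ} [Fact p.Prime]
  [ContinuousSMul ℤ_[p] (W.tateModule p)] {κ : ZpExtension ℚ p} {γ : absoluteGaloisGroup ℚ}
  (I : IwasawaH1Data W p κ γ) {F : Type*} [AddCommGroup F] [Module (IwasawaAlgebra p) F]

/-- **`λ(0) ≠ 0` from the non-torsion of `proj₀ 𝐲`.**  For an injective `Λ`-linear `j : 𝐇¹_Γ → F` with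
finite cokernel and a factorisation `j 𝐲 = λ • z`: if `I.proj 0 𝐲` is not of finite order, then the
augmentation `λ(0)` is non-zero (module docstring, §2). [cite: Kato2004Asterisque, Lemma 13.10 (1) (p. 230) and §14.14 (14.14.1) (p. 243)] -/
theorem constantCoeff_ne_zero_of_hull_smul (j : I.H →ₗ[IwasawaAlgebra p] F) (hj : Injective j)
    (hfin : Finite (F ⧸ LinearMap.range j)) {y : I.H} {lam : IwasawaAlgebra p} {z : F}
    (h : j y = lam • z) (hy : ¬ IsOfFinAddOrder (I.proj 0 y)) :
    PowerSeries.constantCoeff lam ≠ 0 := by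
  intro h0
  -- `λ = X · μ`
  obtain ⟨μ, hμ⟩ : (PowerSeries.X : IwasawaAlgebra p) ∣ lam := PowerSeries.X_dvd_iff.mpr h0
  -- some non-zero constant pushes `μ • z` into the image of `j`
  haveI := hfin
  obtain ⟨c, hc, hmem⟩ := exists_C_smul_mem_of_finite_quotient p (LinearMap.range j) (μ • z)
  obtain ⟨h₁, hh₁⟩ := LinearMap.mem_range.mp hmem
  -- `j (C c • y) = j (X • h₁)`
  have key : (PowerSeries.C c : IwasawaAlgebra p) • y = (PowerSeries.X : IwasawaAlgebra p) • h₁ := by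
    apply hj
    rw [map_smul, map_smul, h, hμ, hh₁, mul_smul, smul_comm (PowerSeries.C c : IwasawaAlgebra p)]
  have hproj : c • I.proj 0 y = 0 := by
    rw [← I.proj_C_smul, key, I.proj_zero_X_smul]
  exact hy (IntegralH1RankZero.isOfFinAddOrder_of_smul_eq_zero p hc hproj)

/-- `𝐲 ≠ 0` when `proj₀ 𝐲` is not of finite order. [folklore] -/
theorem ne_zero_of_not_isOfFinAddOrder_proj_zero {y : I.H} (hy : ¬ IsOfFinAddOrder (I.proj 0 y)) :
    y ≠ 0 := by
  rintro rfl
  exact hy (by rw [map_zero]; exact IsOfFinAddOrder.zero)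

/-- **`z ≠ 0` from the non-torsion of `proj₀ 𝐲`**: for injective `j` and `j 𝐲 = λ • z`, `z = 0` would force
`𝐲 = 0`. [cite: Kato2004Asterisque, Thm. 12.5 (1) (p. 221)] -/
theorem ne_zero_of_hull_smul (j : I.H →ₗ[IwasawaAlgebra p] F) (hj : Injective j) {y : I.H}
    {lam : IwasawaAlgebra p} {z : F} (h : j y = lam • z) (hy : ¬ IsOfFinAddOrder (I.proj 0 y)) :
    z ≠ 0 := by
  rintro rfl
  apply ne_zero_of_not_isOfFinAddOrder_proj_zero I hy
  apply hj
  rw [h, smul_zero, map_zero]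

end Pin

/-! ## §3 On the zeta package over a `ZetaBody` lift -/

section Zeta

variable {W : WeierstrassCurve ℚ} [W.IsElliptic] {p : ℕ} [Fact p.Prime]
  [ContinuousSMul ℤ_[p] (W.tateModule p)] [Module.Free ℤ_[p] (W.tateModule p)]
  [Module.Finite ℤ_[p] (W.tateModule p)] {N : ℕ} [NeZero N] {f : CuspForm (Gamma0 N) 2}
  {ι : (m : ℕ) → (CyclotomicField m ℚ →+* ℂ)} {κ' : ℝ}
  {Λ : ∀ (k : ℕ) (r : Finset (HeightOneSpectrum (𝓞 ℚ))),
    H1 (tateRep W p) (cycSubgroup p k r) →ₗ[ℤ_[p]] ℚ_[p] ⊗[ℚ] CyclotomicField (cycLevel p k r) ℚ}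
  {c d a : ℤ} {A : ℕ}
  {z : ∀ (k : ℕ) (r : (cyclotomicLevelsRat p (badPlaces c d A N)).Ideals),
    H1 (tateRep W p) ((cyclotomicLevelsRat p (badPlaces c d A N)).level k r.1)}
  {x : ∀ (k : ℕ) (r : (cyclotomicLevelsRat p (badPlaces c d A N)).Ideals),
    CyclotomicField (cycLevel p k r.1) ℚ}
  {V : WeierstrassCurve ℚ} [V.IsElliptic]
  {κ : ZpExtension ℚ p} {γ : absoluteGaloisGroup ℚ} {I : IwasawaH1Data W p κ γ} {y : I.H}

/-- **The clause `lam_constantCoeff_ne_zero` re-derived WITHOUT using it** on `Z : MemberHullZetaInputs W p κ γ I 𝐲`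
over the lift of a `ZetaBody` witness (`κ′ ≠ 0`, `f` the newform of a curve `V` with `L(V,1) ≠ 0`, (C5) guards,
non-zero four-cusp factor): `Z.lam(0) ≠ 0` — from `Z.j`, `Z.j_injective`, `Z.finite_coker`, `Z.j_y` and
`MemberIndexOfValue.not_isOfFinAddOrder_proj_zero_of_zetaBody`.
[cite: Kato2004Asterisque, Lemma 13.10 (1) (p. 230), Thm. 12.5 (1) (p. 221), Thm. 14.5 (2) (p. 236)] -/
theorem MemberHullZetaInputs.lam_constantCoeff_ne_zero_of_value (Z : MemberHullZetaInputs W p κ γ I y)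
    (hκ : κ.IsCyclotomic) (hp : p ≠ 2)
    (hbody : ZetaBody W p f ι κ' Λ c d a A z x) (hκ' : κ' ≠ 0)
    (hf : IsNewformOf V f) (hL1 : V.entireLFunction 1 ≠ 0) (hA : 0 < A) (d' : ℤ)
    (hcd : Int.gcd (c * d) A = 1) (hdd' : d * d' ≡ 1 [ZMOD (A : ℤ)])
    (hR : cuspFactor f true (fun _ ↦ 1) c d a A d' ≠ 0)
    (hy : ∀ n : ℕ, I.proj n y = levelToLayer W p hκ hp (badPlaces c d A N) n
      (z (n + 1) (cyclotomicLevelsRat p (badPlaces c d A N)).idealOne)) :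
    PowerSeries.constantCoeff Z.lam ≠ 0 :=
  constantCoeff_ne_zero_of_hull_smul I Z.j Z.j_injective Z.finite_coker Z.j_y
    (MemberIndexOfValue.not_isOfFinAddOrder_proj_zero_of_zetaBody hκ hp hbody hκ' hf hL1 hA d' hcd hdd'
      hR hy)

/-- **The clause `z_ne_zero` re-derived WITHOUT using it** on the same data: `Z.z ≠ 0`.
[cite: Kato2004Asterisque, Thm. 12.5 (1) (p. 221) and Thm. 14.5 (2) (p. 236)] -/
theorem MemberHullZetaInputs.z_ne_zero_of_value (Z : MemberHullZetaInputs W p κ γ I y)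
    (hκ : κ.IsCyclotomic) (hp : p ≠ 2)
    (hbody : ZetaBody W p f ι κ' Λ c d a A z x) (hκ' : κ' ≠ 0)
    (hf : IsNewformOf V f) (hL1 : V.entireLFunction 1 ≠ 0) (hA : 0 < A) (d' : ℤ)
    (hcd : Int.gcd (c * d) A = 1) (hdd' : d * d' ≡ 1 [ZMOD (A : ℤ)])
    (hR : cuspFactor f true (fun _ ↦ 1) c d a A d' ≠ 0)
    (hy : ∀ n : ℕ, I.proj n y = levelToLayer W p hκ hp (badPlaces c d A N) n
      (z (n + 1) (cyclotomicLevelsRat p (badPlaces c d A N)).idealOne)) :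
    Z.z ≠ 0 :=
  ne_zero_of_hull_smul I Z.j Z.j_injective Z.j_y
    (MemberIndexOfValue.not_isOfFinAddOrder_proj_zero_of_zetaBody hκ hp hbody hκ' hf hL1 hA d' hcd hdd'
      hR hy)

end Zeta

end Summit.BirchSwinnertonDyer.BirchSwinnertonDyer.Theorems.MemberHullNondegenerate

end
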